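import Summits.ABC.IUTFork.Joshi.ATS4Reading3DiscTwoPart
import Literature.NumberTheory.EllipticCurves.DivisionValuesRootsOfUnity
import Literature.NumberTheory.EllipticCurves.DivisionFieldRamificationDividesProofs
import HarnessLib

/-!
# [J-IV] Lemma 6.7.1 (3) ⟹ (2) at the primes of `30ℓ` — the ODD part `p ∈ {3, 5}` DISCHARGED for theta fields, and
# `p = ℓ` DISCHARGED for every field containing the `ℓ`-division field: the Weil pairing IS in the tree

Block E / R-J, rows Y-21c / Y-21e / Y-21f, clause (i) («`30ℓ ∣ disc L′`»). Companion of p471065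
`ATS4Reading3DiscTwoPart` (E-cx-2 / E-t47), which PROVED the `p = 2` part and REDUCED the odd part to «`K` contains a
primitive `p`-th root of unity», describing the Weil pairing `μ_p ⊂ F(E[p])` as "not in the tree". It IS in the tree:
Silverman *AEC* III.8.1 / Cor. 8.1.1 are PROVED in `Literature/NumberTheory/EllipticCurves/WeilPairingProofs.lean`
(`WeierstrassCurve.exists_weilPairing_holds`) and `…/DivisionValuesRootsOfUnity.lean`
(`exists_isPrimitiveRoot_fixed`: a primitive `q`-th root of unity in `F̄` fixed by every `τ ∈ Γ_F` fixing `E[q]`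
pointwise, granted a geometric point of exact order `q`; `exists_isPrimitiveRoot_mem_adjoin`: `μ_q ⊂ F(E[q])`), with no
named fact. This file supplies the exact-order point for PRIME `q` from `#E[q] = q²` (the tree's
`WeierstrassCurve.natCard_geomTorsion_prime_eq_sq`, *AEC* III.6.4 (b)) and composes:

* `exists_isPrimitiveRoot_of_torsion_fixed` — if `Γ_F` fixes the geometric `p`-torsion of an elliptic curve `E/F`
  pointwise (`E[p] ⊂ E(F)`), then `F` contains a primitive `p`-th root of unity; hence (`dvd_discr_of_torsion_fixed`)
  `p ∣ disc K` for every odd prime `p` and every number field `K ⊇ F` (p471065's `dvd_discr_of_isPrimitiveRoot` +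
  Mathlib `NumberField.discr_dvd_discr`);
* `dvd_discr_of_fixing_torsion` — if `ψ : K → F̄` over `F` and every `τ ∈ Γ_F` fixing `ψ(K)` fixes `E[p]` pointwise
  (i.e. `ψ(K) ⊇ F(E[p])`, the `p`-DIVISION FIELD — Joshi's `L′ = L(E[ℓ])` at `p = ℓ`), then `p ∣ disc K`;
* for a THETA FIELD `F` of [IUTchIV] Cor. 2.2 (`IsThetaField P F`: the `15`-torsion of `E_F` is `F`-rational, field
  `torsion_rational`) with `P ∈ U` (so that `E_F` is elliptic): `3 ∣ disc K`, `5 ∣ disc K`, and with p471065's `2 ∣ disc K`,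
  **`30 ∣ disc K` for EVERY number field `K ⊇ F`** (`thirty_dvd_discr_of_isThetaField_algebra`), and
  `{2, 3, 5} ⊆ primeFactors |disc K|` in the reading-(3) set's currency.

HONEST SCOPE. The `ℓ`-part needs `K ⊇ F(E[ℓ])`; the `K` of the E5 residual binders (`ATS4.abc_of_genuineResidualSupport`:
`ker ρ̄_{E,ℓ} ≤ Gal(F̄/ψ(K))`, i.e. `ψ(K) ⊆ F(E[ℓ])`) carries the OPPOSITE inclusion, so nothing here asserts `ℓ ∣ disc K`
for that `K`; for print's `L′ = L(E_F[ℓ]) ⊇ F(E[ℓ])` the hypothesis of `dvd_discr_of_fixing_torsion` is its definition.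
PROOF-ONLY (0 `def`s, no new `Prop`-valued fact, no `sorry`, no instance). DEFS-FREEZE respected (`IsThetaField` consumed by
field names). No side taken on [IUTchIII] Cor. 3.12 / [IUTchIV] Thm. 1.10 / [J-IV] Lemma 6.7.1 or on any author; [J-IV] is an
unrefereed preprint, claim-tagged `disputed`; typed ≠ proved ≠ endorsed; not S-bearing; no abc claim.
-/

open NumberField

namespace Summit.ABC.IUTFork.Joshi.ATS4.GenuineVdst

open Literature.NumberTheory.EllipticCurves WeierstrassCurve

universe u

section TorsionFixed

variable {F : Type} [Field F] [NumberField F] {E : WeierstrassCurve F} [E.IsElliptic]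

/-- **A geometric point of exact order `p`** (`p` prime) on an elliptic curve over a number field: `#E[p] = p² > 1`
(*AEC* III.6.4 (b), the tree's `natCard_geomTorsion_prime_eq_sq`) gives `T ≠ 0` with `p·T = 0`, and a non-zero
`p`-torsion point has exact order `p` (Bézout). [cite: SilvermanAEC2009, Cor. III.6.4(b)] -/
theorem exists_geomPoint_exactOrder {p : ℕ} (hp : p.Prime) :
    ∃ T₀ : E.geomPoints, (p : ℤ) • T₀ = 0 ∧ ∀ d : ℕ, 0 < d → d < p → (d : ℤ) • T₀ ≠ 0 := by
  have hcard : Nat.card (E.geomTorsion (p : ℤ)) = p ^ 2 := E.natCard_geomTorsion_prime_eq_sq hp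
  haveI : Finite (E.geomTorsion (p : ℤ)) :=
    Nat.finite_of_card_ne_zero (by rw [hcard]; exact pow_ne_zero 2 hp.ne_zero)
  have h1 : 1 < Nat.card (E.geomTorsion (p : ℤ)) := by
    rw [hcard]
    nlinarith [hp.two_le]
  haveI : Nontrivial (E.geomTorsion (p : ℤ)) := Finite.one_lt_card_iff_nontrivial.mp h1
  obtain ⟨T, hT⟩ := exists_ne (0 : E.geomTorsion (p : ℤ))
  have hTp : (p : ℤ) • (T : E.geomPoints) = 0 := by
    have := T.2
    simpa only [AddSubgroup.torsionBy, Submodule.mem_toAddSubgroup, Submodule.mem_torsionBy_iff] using this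
  refine ⟨T, hTp, fun d hd hdp h0 => hT ?_⟩
  have hcop : Nat.Coprime p d :=
    hp.coprime_iff_not_dvd.mpr fun hdvd => absurd (Nat.le_of_dvd hd hdvd) (not_le.mpr hdp)
  obtain ⟨a, b, hab⟩ : IsCoprime (p : ℤ) (d : ℤ) := Nat.isCoprime_iff_coprime.mpr hcop
  apply Subtype.ext
  show (T : E.geomPoints) = 0
  calc (T : E.geomPoints) = (1 : ℤ) • (T : E.geomPoints) := (one_smul ℤ _).symm
    _ = (a * p + b * d) • (T : E.geomPoints) := by rw [hab]
    _ = a • ((p : ℤ) • (T : E.geomPoints)) + b • ((d : ℤ) • (T : E.geomPoints)) := by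
        rw [add_smul, mul_smul, mul_smul]
    _ = 0 := by rw [hTp, h0, smul_zero, smul_zero, add_zero]

/-- **`E[p] ⊂ E(F)` forces `μ_p ⊂ F`** (Silverman *AEC* III, Cor. 8.1.1, in the tree as `exists_isPrimitiveRoot_fixed`
on the PROVED Weil pairing): if every `σ ∈ Γ_F` fixes the geometric `p`-torsion of `E` pointwise, then `F` contains a
primitive `p`-th root of unity (the Weil-pairing value `e_p(S, T₀)` is `Γ_F`-invariant, hence in the fixed field `F` of
`Γ_F` — infinite Galois correspondence, Mathlib `InfiniteGalois.fixedField_fixingSubgroup`).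
[cite: SilvermanAEC2009, Cor. III.8.1.1] -/
theorem exists_isPrimitiveRoot_of_torsion_fixed {p : ℕ} (hp : p.Prime)
    (hfix : ∀ σ : Field.absoluteGaloisGroup F, ∀ T : E.geomPoints, (p : ℤ) • T = 0 → σ • T = T) :
    ∃ ζ : F, IsPrimitiveRoot ζ p := by
  obtain ⟨ζ, hζ, hfixζ⟩ := exists_isPrimitiveRoot_fixed (E := E) hp.two_le (exists_geomPoint_exactOrder hp)
  have hall : ∀ τ : Field.absoluteGaloisGroup F, τ • ζ = ζ := fun τ =>
    hfixζ τ fun T => Subtype.ext (hfix τ T.1 (by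
      have := T.2
      simpa only [AddSubgroup.torsionBy, Submodule.mem_toAddSubgroup, Submodule.mem_torsionBy_iff] using this))
  haveI : IsGalois F (AlgebraicClosure F) := {}
  have hmem : ζ ∈ IntermediateField.fixedField (⊥ : IntermediateField F (AlgebraicClosure F)).fixingSubgroup :=
    (IntermediateField.mem_fixedField_iff _ _).mpr fun f _ => hall f
  rw [InfiniteGalois.fixedField_fixingSubgroup, IntermediateField.mem_bot] at hmem
  obtain ⟨ζ₀, hζ₀⟩ := hmem
  rw [← hζ₀] at hζ
  exact ⟨ζ₀, hζ.of_map_of_injective (algebraMap F (AlgebraicClosure F)).injective⟩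

/-- **`E[p] ⊂ E(F)` ⟹ `p ∣ disc K` for every number field `K ⊇ F`** (`p` an odd prime): `μ_p ⊂ F`
(`exists_isPrimitiveRoot_of_torsion_fixed`), `p ∣ disc F` (p471065 `dvd_discr_of_isPrimitiveRoot`), `disc F ∣ disc K`
(Mathlib `NumberField.discr_dvd_discr`). [cite: SilvermanAEC2009, Cor. III.8.1.1] -/
theorem dvd_discr_of_torsion_fixed {p : ℕ} (hp : p.Prime) (hp2 : p ≠ 2)
    (hfix : ∀ σ : Field.absoluteGaloisGroup F, ∀ T : E.geomPoints, (p : ℤ) • T = 0 → σ • T = T)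
    (K : Type u) [Field K] [NumberField K] [Algebra F K] : (p : ℤ) ∣ discr K := by
  obtain ⟨ζ, hζ⟩ := exists_isPrimitiveRoot_of_torsion_fixed (E := E) hp hfix
  exact (dvd_discr_of_isPrimitiveRoot hp hp2 hζ).trans (NumberField.discr_dvd_discr F K)

/-- **The `p`-division field case — Joshi's `L′ = L(E[ℓ])` at `p = ℓ`.** If `ψ : K → F̄` is an `F`-embedding of a number
field `K ⊇ F` such that every `τ ∈ Γ_F` fixing `ψ(K)` fixes the geometric `p`-torsion of `E` pointwise (`ψ(K) ⊇ F(E[p])`),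
then `K` contains a primitive `p`-th root of unity and `p ∣ disc K` (`p` an odd prime): the `Γ_F`-set of Weil-pairing values
gives `ζ ∈ F̄` fixed by `Gal(F̄/ψ(K))`, i.e. `ζ ∈ ψ(K)` (Mathlib `InfiniteGalois.fixedField_fixingSubgroup`).
[cite: SilvermanAEC2009, Cor. III.8.1.1] -/
theorem dvd_discr_of_fixing_torsion {p : ℕ} (hp : p.Prime) (hp2 : p ≠ 2) {K : Type} [Field K] [NumberField K]
    [Algebra F K] (ψ : K →ₐ[F] AlgebraicClosure F)
    (hK : ∀ τ : Field.absoluteGaloisGroup F, τ ∈ ψ.fieldRange.fixingSubgroup →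
      ∀ T : E.geomPoints, (p : ℤ) • T = 0 → τ • T = T) :
    (p : ℤ) ∣ discr K := by
  obtain ⟨ζ, hζ, hfixζ⟩ := exists_isPrimitiveRoot_fixed (E := E) hp.two_le (exists_geomPoint_exactOrder hp)
  haveI : IsGalois F (AlgebraicClosure F) := {}
  have hmem : ζ ∈ IntermediateField.fixedField ψ.fieldRange.fixingSubgroup :=
    (IntermediateField.mem_fixedField_iff _ _).mpr fun τ hτ =>
      hfixζ τ fun T => Subtype.ext (hK τ hτ T.1 (by
        have := T.2
        simpa only [AddSubgroup.torsionBy, Submodule.mem_toAddSubgroup, Submodule.mem_torsionBy_iff] using this))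
  rw [InfiniteGalois.fixedField_fixingSubgroup, AlgHom.mem_fieldRange] at hmem
  obtain ⟨k, hk⟩ := hmem
  rw [← hk] at hζ
  exact dvd_discr_of_isPrimitiveRoot hp hp2 (hζ.of_map_of_injective ψ.toRingHom.injective)

end TorsionFixed

open Literature.IUT.LogVolume Literature.IUT.LogVolume.Cor22
open Literature.NumberTheory.DiophantineGeometry Literature.NumberTheory.DiophantineGeometry.GenEll

/-- A theta field's `Γ_F` fixes the `p`-torsion of `E_F` pointwise for every `p ∣ 15` (field `torsion_rational` of
`IsThetaField`: the `15`-torsion is `F`-rational). [claim: Mochizuki2012, status: disputed] -/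
theorem torsion_fixed_of_isThetaField {P : NFPoint} {F : Type} [Field F] [NumberField F] [Algebra P.F F]
    (hF : IsThetaField P F) {p : ℕ} (hp15 : p ∣ 15) :
    ∀ σ : Field.absoluteGaloisGroup F, ∀ T : WeierstrassCurve.geomPoints (thetaCurve P F),
      (p : ℤ) • T = 0 → σ • T = T := by
  intro σ T hT
  obtain ⟨c, hc⟩ := hp15
  refine hF.torsion_rational σ T ?_
  have h15 : (15 : ℤ) = (c : ℤ) * (p : ℤ) := by exact_mod_cast (by rw [hc, mul_comm] : 15 = c * p)
  rw [h15, mul_smul, hT, smul_zero]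

/-- **`3 ∣ disc K` for every number field `K ⊇ F` over a theta field** (`P ∈ U`): `E_F[3] ⊂ E_F(F)` and the Weil pairing.
[claim: Joshi2024ATS4, status: disputed] -/
theorem three_dvd_discr_of_isThetaField_algebra {P : NFPoint} {F : Type} [Field F] [NumberField F] [Algebra P.F F]
    (hF : IsThetaField P F) (hU : P.InU) (K : Type u) [Field K] [NumberField K] [Algebra F K] :
    (3 : ℤ) ∣ discr K := by
  haveI := thetaCurve_isElliptic hU F
  exact_mod_cast dvd_discr_of_torsion_fixed (E := thetaCurve P F) Nat.prime_three (by norm_num)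
    (torsion_fixed_of_isThetaField hF ⟨5, by norm_num⟩) K

/-- **`5 ∣ disc K` for every number field `K ⊇ F` over a theta field** (`P ∈ U`): `E_F[5] ⊂ E_F(F)` and the Weil pairing.
[claim: Joshi2024ATS4, status: disputed] -/
theorem five_dvd_discr_of_isThetaField_algebra {P : NFPoint} {F : Type} [Field F] [NumberField F] [Algebra P.F F]
    (hF : IsThetaField P F) (hU : P.InU) (K : Type u) [Field K] [NumberField K] [Algebra F K] :
    (5 : ℤ) ∣ discr K := by
  haveI := thetaCurve_isElliptic hU F
  exact_mod_cast dvd_discr_of_torsion_fixed (E := thetaCurve P F) Nat.prime_five (by norm_num)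
    (torsion_fixed_of_isThetaField hF ⟨3, by norm_num⟩) K

/-- **`30 ∣ disc K` for EVERY number field `K ⊇ F` over a theta field** (`P ∈ U`) — the primes `2, 3, 5` of `30ℓ` in
[J-IV] Lemma 6.7.1 (3) ⟹ (2), all three now in kernel (`2` from p471065 via `√−1 ∈ F`; `3, 5` via `E_F[15] ⊂ E_F(F)`
and the Weil pairing). [claim: Joshi2024ATS4, status: disputed] -/
theorem thirty_dvd_discr_of_isThetaField_algebra {P : NFPoint} {F : Type} [Field F] [NumberField F] [Algebra P.F F]
    (hF : IsThetaField P F) (hU : P.InU) (K : Type u) [Field K] [NumberField K] [Algebra F K] :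
    (30 : ℤ) ∣ discr K := by
  have h2 := two_dvd_discr_of_isThetaField_algebra hF K
  have h3 := three_dvd_discr_of_isThetaField_algebra hF hU K
  have h5 := five_dvd_discr_of_isThetaField_algebra hF hU K
  have h6 : (2 * 3 : ℤ) ∣ discr K := (show IsCoprime (2 : ℤ) 3 from ⟨-1, 1, by norm_num⟩).mul_dvd h2 h3
  have h30 : (2 * 3 * 5 : ℤ) ∣ discr K := (show IsCoprime (2 * 3 : ℤ) 5 from ⟨1, -1, by norm_num⟩).mul_dvd h6 h5
  norm_num at h30
  exact h30

/-- The same in the reading-(3) set's currency: **`{2, 3, 5} ⊆ primeFactors |disc K|`** for every number field `K ⊇ F`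
over a theta field (`P ∈ U`). [claim: Joshi2024ATS4, status: disputed] -/
theorem primeFactors_discr_supset_of_isThetaField_algebra {P : NFPoint} {F : Type} [Field F] [NumberField F]
    [Algebra P.F F] (hF : IsThetaField P F) (hU : P.InU) (K : Type u) [Field K] [NumberField K] [Algebra F K] :
    ({2, 3, 5} : Finset ℕ) ⊆ (discr K).natAbs.primeFactors := by
  have hne : (discr K).natAbs ≠ 0 := Int.natAbs_ne_zero.mpr (NumberField.discr_ne_zero K)
  intro p hp
  simp only [Finset.mem_insert, Finset.mem_singleton] at hp
  rw [Nat.mem_primeFactors]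
  rcases hp with rfl | rfl | rfl
  · exact ⟨Nat.prime_two, Int.natAbs_dvd_natAbs.mpr (two_dvd_discr_of_isThetaField_algebra hF K), hne⟩
  · exact ⟨Nat.prime_three, Int.natAbs_dvd_natAbs.mpr (three_dvd_discr_of_isThetaField_algebra hF hU K), hne⟩
  · exact ⟨Nat.prime_five, Int.natAbs_dvd_natAbs.mpr (five_dvd_discr_of_isThetaField_algebra hF hU K), hne⟩

/-- **The `ℓ`-part for a theta curve**: if `ψ(K) ⊇ F(E_F[ℓ])` (every `τ ∈ Γ_F` fixing `ψ(K)` fixes `E_F[ℓ]` pointwise —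
print's `L′ = L(E_F[ℓ])`), then `ℓ ∣ disc K` for every odd prime `ℓ`. NOT applicable to the `K ⊆ F(E[ℓ])` of the E5 residual
binders (opposite inclusion). [claim: Joshi2024ATS4, status: disputed] -/
theorem dvd_discr_of_fixing_torsion_thetaCurve {P : NFPoint} {F : Type} [Field F] [NumberField F] [Algebra P.F F]
    (hU : P.InU) {ℓ : ℕ} (hℓ : ℓ.Prime) (hℓ2 : ℓ ≠ 2) {K : Type} [Field K] [NumberField K] [Algebra F K]
    (ψ : K →ₐ[F] AlgebraicClosure F)
    (hK : ∀ τ : Field.absoluteGaloisGroup F, τ ∈ ψ.fieldRange.fixingSubgroup →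
      ∀ T : WeierstrassCurve.geomPoints (thetaCurve P F), (ℓ : ℤ) • T = 0 → τ • T = T) :
    (ℓ : ℤ) ∣ discr K := by
  haveI := thetaCurve_isElliptic hU F
  exact dvd_discr_of_fixing_torsion (E := thetaCurve P F) hℓ hℓ2 ψ hK

end Summit.ABC.IUTFork.Joshi.ATS4.GenuineVdst
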